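import Summits.BirchSwinnertonDyer.BirchSwinnertonDyer.Theorems.ManinLocalTwoThreePShiftTransferStep
import Summits.BirchSwinnertonDyer.BirchSwinnertonDyer.Theorems.ManinLocalTwoThreeShiftCompatiblePairRigidity
import HarnessLib

/-!
# The prime-generic transfer step, IV: the base bridged from p2's Serre rigidity, and `K_p(pM) = D(pM)` UNCONDITIONALLY for `p ≥ 5`
# (route `ManinLocalTwoThree`, cell bsd-f2-manin; cruxes C2 stmt-BirchSwinnertonDyer-22967 / C3 stmt-…-22968; LEAD seat p1 gen 12;
# the LEAD's prime-generic shift-equaliser conjecture, HOME/p1/CENSUS-shift-equaliser-p1-g11.md, at `v_p(N) ≤ 1`)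

* `shiftInvariantIsDiamondAtP_of_not_dvd`: p2's Serre-amalgam rigidity `shiftInvariant_isDiamond` (degeneracy-conjugation form, every prime,
  every `K` killed by `p`) restated in the `g0Of` vocabulary: `ShiftInvariantIsDiamondAtP p N K` for `p ∤ N`, `N ≥ 1` — `K_p(N) = D(N)`.
* **`shiftInvariantIsDiamondAtP_prime_mul`**: for every prime `p ≥ 5`, every `M ≥ 1` prime to `p` and every commutative ring `K` with `p = 0`,
  every additive `p`-shift-invariant `φ : Γ₀(pM) → K` is a diamond class — `K_p(pM) = D(pM)`: Ihara's lemma with trivial `p`-torsion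
  coefficients at `p ∥ N`, Eisenstein part INCLUDED (base + the transfer `shiftInvariantIsDiamondAtP_mul` of file III).  Together with the
  tree's `p = 3` (`threeShiftInvariantIsDiamondAt_all`) and `p = 2` (p3's G₂ chain) files this is the prime-generic law at `v_p(N) ≤ 1` for ALL `p`.
Nothing about BSD, Manin's conjecture or C2/C3 is proved here (structure theorem about `Γ₀(N)`).
[cite: DarmonDiamondTaylor1995, Lemma 4.28 (p. 135) (shape: degeneracy maps on `Γ₀`)]
-/

set_option autoImplicit false
set_option linter.dupNamespace false

open scoped MatrixGroups

open CongruenceSubgroup Matrix.SpecialLinearGroup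
  Summit.BirchSwinnertonDyer.Rank1Residual.ManinAdditive.NineShiftEqualiser

namespace Summit.BirchSwinnertonDyer.BirchSwinnertonDyer.Theorems.ManinLocalTwoThree

namespace PShiftTransfer

open ThreeShiftDescent TwoShift

variable {p : ℕ} [Fact p.Prime] {M : ℕ}

/-- **The base, bridged**: p2's Serre-amalgam rigidity `shiftInvariant_isDiamond` (degeneracy-conjugation form) gives
`K_p(N) = D(N)` in the `g0Of` vocabulary at every level `N ≥ 1` prime to `p`, for every `K` killed by `p`. [folklore] -/
theorem shiftInvariantIsDiamondAtP_of_not_dvd {K : Type} [CommRing K] (hpK : (p : K) = 0) {N : ℕ} (hN : 0 < N)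
    (hpN : ¬ p ∣ N) : ShiftInvariantIsDiamondAtP p N K := by
  have hp : p.Prime := Fact.out
  haveI : NeZero p := ⟨hp.ne_zero⟩
  intro φ hadd hinv γ hγ
  refine shiftInvariant_isDiamond hp hN hpN (fun x => by rw [nsmul_eq_mul, hpK, zero_mul]) φ hadd ?_ γ hγ
  intro γ'
  -- entries of `γ' ∈ Γ₀(Np)`: `c = p c₀` with `N ∣ c₀`
  have hcNp : ((N * p : ℕ) : ℤ) ∣ ((γ' : SL(2, ℤ)) 1 0 : ℤ) :=
    (ZMod.intCast_zmod_eq_zero_iff_dvd _ _).mp (Gamma0_mem.mp γ'.2)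
  obtain ⟨c₀, hc₀⟩ : (p : ℤ) ∣ ((γ' : SL(2, ℤ)) 1 0 : ℤ) := dvd_trans (by push_cast; exact dvd_mul_left _ _) hcNp
  have hNc₀ : (N : ℤ) ∣ c₀ := by
    have h := hcNp
    rw [hc₀] at h
    push_cast at h
    rw [mul_comm (N : ℤ)] at h
    exact Int.dvd_of_mul_dvd_mul_left (by exact_mod_cast hp.ne_zero) h
  have hdet : ((γ' : SL(2, ℤ)) 0 0 : ℤ) * (γ' : SL(2, ℤ)) 1 1 - ((γ' : SL(2, ℤ)) 0 1 : ℤ) * (p * c₀) = 1 := by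
    rw [← hc₀]; exact gamma0_det_entries γ'
  have key := hinv ((γ' : SL(2, ℤ)) 0 0) ((γ' : SL(2, ℤ)) 0 1) c₀ ((γ' : SL(2, ℤ)) 1 1) hdet hNc₀
  rw [one_mul] at key
  have e1 : Literature.NumberTheory.EllipticCurves.ModularForms.Gamma0.degeneracyConj N (N * p) 1
      (mul_dvd_mul_left N (one_dvd p)) γ' =
      g0Of ((γ' : SL(2, ℤ)) 0 0) ((γ' : SL(2, ℤ)) 0 1) (p * c₀) ((γ' : SL(2, ℤ)) 1 1) hdet (Dvd.dvd.mul_left hNc₀ p) := by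
    apply Subtype.ext
    rw [Literature.NumberTheory.EllipticCurves.ModularForms.Gamma0.coe_degeneracyConj_one]
    ext i j
    fin_cases i <;> fin_cases j <;> simp [g0Of, slOf, hc₀]
  have e2 : Literature.NumberTheory.EllipticCurves.ModularForms.Gamma0.degeneracyConj N (N * p) p dvd_rfl γ' =
      g0Of ((γ' : SL(2, ℤ)) 0 0) (p * (γ' : SL(2, ℤ)) 0 1) c₀ ((γ' : SL(2, ℤ)) 1 1) (by linear_combination hdet) hNc₀ := by
    apply Subtype.ext
    ext i j
    fin_cases i <;> fin_cases j <;>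
      simp [Literature.NumberTheory.EllipticCurves.ModularForms.Gamma0.degeneracyConj_apply, g0Of, slOf, hc₀,
        Int.mul_ediv_cancel_left _ (show (p : ℤ) ≠ 0 by exact_mod_cast hp.ne_zero)]
  rw [e1, e2, key]

/-- **`K_p(pM) = D(pM)` UNCONDITIONALLY for every prime `p ≥ 5` and every `M ≥ 1` prime to `p`**, over every `K` with `p = 0`: the
prime-generic shift-equaliser law at `v_p(N) = 1` — Ihara's lemma with trivial `p`-torsion coefficients at `p ∥ N`, Eisenstein part
included (p2's base + this file's transfer). [new] -/
theorem shiftInvariantIsDiamondAtP_prime_mul {K : Type} [CommRing K] (hpK : (p : K) = 0) (h5 : 5 ≤ p) (hM : 0 < M)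
    (hpM : ¬ p ∣ M) : ShiftInvariantIsDiamondAtP p (p * M) K :=
  shiftInvariantIsDiamondAtP_mul hpK h5 hpM (shiftInvariantIsDiamondAtP_of_not_dvd hpK hM hpM)


end PShiftTransfer

end Summit.BirchSwinnertonDyer.BirchSwinnertonDyer.Theorems.ManinLocalTwoThree
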